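import Summits.QuantumFields.YangMills.Theorems.BalabanUVNodesN12MinimiserFamilyOfClassNearFlatCoercive
import Literature.MathematicalPhysics.QuantumFieldTheory.Balaban1983to89.Node00.MultiScaleFibreChartB
import Literature.MathematicalPhysics.QuantumFieldTheory.Balaban1983to89.B15Prop1LinearisedKernelLevelZeroB
import Literature.MathematicalPhysics.QuantumFieldTheory.Balaban1983to89.B15Prop1SliceNondegeneracyFromRealCoerciveTowerB
import Summits.QuantumFields.YangMills.Theorems.BalabanUVNodesN12TowerGuardsOfClassB
import Summits.QuantumFields.YangMills.Theorems.BalabanUVNodesN12MinimiserFamilyOfClassTowerGuardsB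
import HarnessLib

/-!
# DAG node N12 [B15] — THE (J0′) PRODUCER OF RECORD WITH THE (β) ROW SPLIT ALONG PRINT'S ROAD «(1.9) ⟸ (1.7) + (1.8)»: the Lagrangian second-variation letter `hposN` REPLACED by a — **BOND-DATUM EDITION** (`…N12MinimiserFamilyOfClassNearFlatCoerciveB`, USED DECLARATIONS ONLY)

The print-datum ([Balaban1984PropagatorsII] (2.3)) (γ) twin of `Summits/…/Theorems/BalabanUVNodesN12MinimiserFamilyOfClassNearFlatCoercive.lean`: the declarations of the parent whose STATEMENT reads the determining datum
(`hMin_atRecord_of_node00Letters_thm1AtBase_central_ofClass_nearFlat`) and which N12's junction of record v14ᴸ uses (dag-n12-c g35 probe-2 census `UsedConstsN12RoadTyped2`, THEOREMS block), re-typed over a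
BOND-LEVEL datum `𝔅 : BDetSet` (F0a `B15DeterminingSetsB`) and dag-n12-c's bond-datum chart `Node00.msChartB` (✓p774329; `msChart 𝐁 = msChartB (bondsDet 𝐁)` by `rfl`).  GENERATOR twin
(this seat's `work/g32/gen_thm.py`, block-extracted from the parent's tree bytes): namespace `…N12MinimiserFamilyOfClassNearFlatCoerciveB`, SAME short names, `DetSet ↦ BDetSet`, `AgreeOn 𝐁 ↦ AgreeOnB 𝔅`,
`IsMinimizer ↦ IsMinimizerB`, `bondsOf (𝐁 j) ↦ 𝔅 j`, `msChart ∕ constrCard ∕ constrEnum ∕ ConstrSet ↦ …B`, NODE 00 chart lemmas `…msChart… ↦ …msChartB…`; proofs VERBATIM; the parent's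
datum-free declarations REUSED BY NAME (`open`), never copied (private plumbing excepted, №366 R2).  The parent's (b) statements are the instances `𝔅 := bondsDet 𝐁`.
STRUCTURAL RE-KEY (dag-n12-c RE-KEY NOTE I.18590, the `S`-device of `B15Prop1EndpointNearFlatLettersWindowB`): the level-0 SUPPORT SET is DISPLAYED — binders `(S₀ : Set (PBond (F.P Kt) 0)) (hS₀ : ∀ b ∉ S₀, b ∈ lamBondsSeq (maxDomT ν.M₁ Z) k 0)` replace the parent`s hard-wired `{b | b.src ∈ Ω₁(Z)}` (reading (b): one end-point); at print`s datum `S₀ := {b | b.src ∈ Ω₁(Z) ∨ b.tgt ∈ Ω₁(Z)}` with `hS₀` = n12-c`s `mem_lamDatumP_maxDomT_zero_of_not_mem₂`; the (δ) row is asked on the plaquettes meeting `S₀`, the kernel-support clause reads `∀ b ∉ S₀, p b = 0`.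
Cell `pub-ymgap` (HUMAN RULINGS D-0062 ∕ D-0149), seat `pub-ymgap-dag-n12-d` g32 (R134 N12 [B15] s2; the (ii) Theorems-side re-key of N12's road at print's [II] (2.3) datum — director-ym №338 ∕
№343 (E1)(iii-b), FLAG №16 ∕ ruling (α); dag-n12-c DESIGN memo a793b2ebc0b803bf (ii); `N12-ROAD-TWIN-ORDER-2026-08-30.md`).  Count-neutral helper of K1⁹ `stmt-QuantumFields-27364`,
`--kind proof --supports … --as helper`.  THEOREMS ONLY (0 `def`, 0 `instance`, 0 `sorry`).

HONEST FRAMING (director-ym №338 (5)).  PURELY ADDITIVE: the parent stays landed and true on its own text; nothing in it is edited; no displayed premise of any consumer is deleted or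
weakened; every hypothesis of the parent stays a hypothesis.  Nothing of Bałaban's analysis asserted; N12 NOT discharged; K0⁷ ∕ K1⁹ NOT closed; counts unmoved (typed 28∕28 · discharged
8∕27, A 8∕28; K 1∕4); one finite 𝕋⁴ programme at fixed ε — R4 closes the conditional rung `BalabanLadder.UV` only; NOT the Yang–Mills mass gap (Clay); nothing continuum ∕ ℝ⁴ ∕ OS.

PARENT's DOCSTRING (the mathematics and the citations; read the site-level `𝐁` as the bond datum `𝔅`):
# DAG node N12 [B15] — THE (J0′) PRODUCER OF RECORD WITH THE (β) ROW SPLIT ALONG PRINT'S ROAD «(1.9) ⟸ (1.7) + (1.8)»: the Lagrangian second-variation letter `hposN` REPLACED by a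
# near-flat bond letter on `Ω₁(Z)` (the direct road's (N)-package shape), a FLAT coercivity letter ((1.8) ∕ [10] (1.67) currency) and a MULTIPLIER letter — the level-`0` support of the
# kernel fields (`Γ₀ = Ω₁ᶜ`) DISCHARGED

[Balaban1989LargeFieldII] = «[LF-II]», p. 357, (1.7)–(1.9) p. 358, (1.12) p. 359; [Balaban1989LargeFieldI] = «[IV]», (1.74) p. 192, Prop. 1 p. 194; [Balaban1985Variational] = «[15]», Thm 1
p. 279, Sect. C (45) p. 285, Sect. G pp. 305–307; [Balaban1988Convergent] = «[III]», (2.2) p. 255, (2.10)–(2.13) pp. 256–257; [Balaban1984PropagatorsI] = «[10]», (1.65)–(1.67).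

Cell `pub-ymgap`, HUMAN RULINGS D-0062 ∕ D-0149, lane owner `pub-ymgap-dag-n12-c` (g25, strategy s1 «first missing estimate»).  Key K1⁹ `stmt-QuantumFields-27364`, `--kind proof --supports …
--as helper`; count-neutral.  NEW leaf; CONSUMED BY NAME, nothing modified: the lane's capstone `…N12MinimiserFamilyOfClassTowerGuards.hMin_atRecord_of_node00Letters_thm1AtBase_central_ofClass`
(g24, p709323), the (β)-split `B15Prop1RealCoerciveFromNearFlatExpansion.realSecondVariation_pos_of_flatCoercive_of_multiplier` (g25), the regularity of the slice datum coordinates under the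
per-tower guards `B15Prop1SliceNondegeneracyFromRealCoerciveTower.analyticAt_sliceDatum_of_guardOn` (g24), the level-`0` kernel dictionary
`B15Prop1LinearisedKernelLevelZero.apply_eq_zero_of_fderiv_sliceDatum_eq_zero_of_mem_bondsOf_zero_of_guardOn` (g25) and the minimiser's guards from its class
`…N12TowerGuardsOfClass.guardOn_towerRegion_Bj_of_mem_class`, r12's `B14.Eq213DetSet.Bj_zero` (`Γ₀ = Ω₁ᶜ`).

WHY (lane memo `N12-UNIFORMITY-SPEC.md` §6; bus 2026-08-29 DAGN12C-G25 STARTED).  After the E1 repair and dag-n12-w6's (45) velocity producer, the (J0′) producer of N12 displays per base field,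
besides print's Theorem-1 rows ((E), (T1@q₀)), the (β) letter `hposN`: positivity of the real second variation of the LAGRANGIAN `A(exp(tp)·U₀) − Re ℓ₀(Φ₀(t·p̂))` on the real kernel of
the linearised constraint — a currency no in-edge of N12 speaks.  Print's road ([LF-II] p. 358): second variation at the near-flat background = flat quadratic form up to `O(δ)·Σ|p_b|²`
((1.7), PROVED in the tree by dag-n12-w2), flat form bounded below on the gauge-fixed constrained subspace ((1.8) ∕ «(1.67) [10]»).  THIS FILE re-displays the (β) row accordingly.

CONTENTS (namespace `Summit.QuantumFields.YangMills.BalabanUVNodes.N12MinimiserFamilyOfClassNearFlatCoercive`; one theorem, no `def`, no `instance`, no `sorry`).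
★★★ `hMin_atRecord_of_node00Letters_thm1AtBase_central_ofClass_nearFlat` — the capstone with, per base field `V_k ∈ K`, the (β) conjunct REPLACED by three print-shaped rows:
(δ) `U₀` within `δc` of `1` on the four bond variables of every plaquette meeting a bond sourced in `Ω₁(Z)` — LITERALLY the near-flat clause of the direct road's (N) package
(`B15Prop1CoerciveAtNormalisedDatum.hcoer_of_nearFlatLettersNormalised_sub_loc`, binder `hNFn`), i.e. a GAUGE letter the road of record already carries and inhabits on normalisable windows;
(P) FLAT COERCIVITY on the real kernel `cP·Σ_b‖p_b‖² ≤ d²∕ds² A(exp(sp)·1)|₀` — the honest first missing estimate of the row ((1.8) ∕ [10] (1.67) on the multi-scale constrained axial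
subspace; b5 ∕ N12-own currency); (M) the MULTIPLIER letter `Re ℓ₀(D²Φ₀(0)[p̂,p̂]) ≤ m·Σ_b‖p_b‖²` for every multiplier of the base state ((45) right inverse × first variation × chart
curvature); once per height the numerics `0 < k`, `0 ≤ δc`, `64(d−1)δc + m < cP`.  The support clause the (β)-split needs — real kernel fields vanish on the bonds sourced off `Ω₁(Z)` — is
DISCHARGED in the proof (level-`0` kernel dictionary at `Γ₀ = Ω₁ᶜ`).  Every other row is the capstone's VERBATIM.

HONEST FRAMING ∕ LOCATED.  Composition by name; (δ) is a GAUGE letter (bondwise near-flatness; at a minimiser it holds after a gauge normalisation of the window — the direct road's (N)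
producers, LOCATED-GEOM v3 for the shape coverage), (P), (M) are DISPLAYED, not proved; nothing of Bałaban's estimates asserted; count-neutral helper; N12 NOT discharged; K1⁹ NOT
closed; counts unmoved; one finite 𝕋⁴ programme at fixed ε — R4 closes the conditional finite-𝕋⁴ rung `BalabanLadder.UV` only; NOT continuum ∕ OS ∕ mass gap ∕ Clay.
-/

noncomputable section

open scoped BigOperators Matrix.Norms.L2Operator Topology

namespace Summit.QuantumFields.YangMills.BalabanUVNodes.N12MinimiserFamilyOfClassNearFlatCoerciveB

open Literature.MathematicalPhysics.QuantumFieldTheory.Balaban1983to89.B15DeterminingSetsB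

open Set Metric Filter
open Literature.MathematicalPhysics.QuantumFieldTheory.Balaban1983to89
open Literature.MathematicalPhysics.QuantumFieldTheory.Balaban1983to89.Node00 (SU coeField coeField_apply SmallBelow ConstrSetB constrCardB constrEnumB)
open T4Continuum B15DeterminingSets GaugeField
open B14.Eq213MaximalDomains (side)
open B14.Eq213DetSet (Bj Bj_of_gt Bj_zero maxDomT)
open B15Prop1Carrier (plaqsInside)
open B15AveragingHolomorphic (iterMh)
open B15ComplexifiedDatumFamily (conjVec)
open B15SU2ChartHolomorphic (genE expMulC logCoordC)
open B15Prop1AnalyticExtClause (cplxVec)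
open B15Prop1ChartCalculusSU2 (E3)
open B15Prop1ChartSU2 (su2Chart)
open B15ShellGauge193 (shellGauge)
open B15Extension193 (extend)
open B16Sect1Backgrounds (toMS expMul)
open ExpMeanLog (expMeanLogSU)
open BlockAveraging (blockAvg)
open T4CubeChartGnomonic (SU2)
open Literature.MathematicalPhysics.QuantumFieldTheory.BalabanImbrieJaffe1984to88.BIJ85Eq453GaugeField (qsstarGIter0)
open B15Prop1RealCoerciveFromNearFlatExpansion (realSecondVariation_pos_of_flatCoercive_of_multiplier)
open B15Prop1SliceNondegeneracyFromRealCoerciveTowerB (analyticAt_sliceDatum_of_guardOn)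
open B15Prop1LinearisedKernelLevelZeroB (apply_eq_zero_of_fderiv_sliceDatum_eq_zero_of_mem_bondsOf_zero_of_guardOn)
open Summit.QuantumFields.YangMills.BalabanUVNodes.N12TowerGuardsOfClassB (guardOn_towerRegion_lamBondsSeq_of_mem_class)
open Summit.QuantumFields.YangMills.BalabanUVNodes.N12MinimiserFamilyOfClassTowerGuardsB (hMin_atRecord_of_node00Letters_thm1AtBase_central_ofClass)
open scoped Matrix.Norms.L2Operator

section
variable {F : T4Family} {k : ℕ}

/-- ★★★ **THE (J0′) PRODUCER AT N12's RECORD WITH THE (β) ROW SPLIT ALONG PRINT'S ROAD «(1.9) ⟸ (1.7) + (1.8)».**  The lane's capstone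
`…N12MinimiserFamilyOfClassTowerGuardsB.hMin_atRecord_of_node00Letters_thm1AtBase_central_ofClass` (determining set of record `𝔅 = 𝐁_k(Z)`, class of record `U_k({Ω_j(Z)}, εreg)`, no
(0.4) guard of any kind) with, per base field `V_k ∈ K`, the (β) conjunct `hposN` (positivity of the real second variation of the Lagrangian on the real kernel of `DΦ₀(0)`) REPLACED by:
(δ) `U₀` within `δc` of `1` on the four bond variables of every plaquette meeting a bond sourced in `Ω₁(Z) = maxDomT ν.M₁ Z 1` (the near-flat clause of the direct road's (N) package,
VERBATIM); (P) FLAT COERCIVITY on the real kernel,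
`cP·Σ_b‖p_b‖² ≤ d²∕ds² A(expMul su2Chart (s•p) 1)|₀`; (M) for every multiplier `ℓ₀` of the base state (`Da(0) = ℓ₀ ∘ DΦ₀(0)`), `Re ℓ₀(D²Φ₀(0)[p̂,p̂]) ≤ m·Σ_b‖p_b‖²` on the real kernel;
and ONCE per height `0 < k`, `0 ≤ δc`, `64(d−1)δc + m < cP`.  The (β) row is then `B15Prop1RealCoerciveFromNearFlatExpansion.realSecondVariation_pos_of_flatCoercive_of_multiplier` ([LF-II]
(1.7) PROVED by dag-n12-w2 + the line calculus) on the bond set `{b | b.src ∈ Ω₁(Z)}`: the `C²` regularity of `Φ₀` comes from the minimiser's per-tower guards read off its class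
(`…N12TowerGuardsOfClass`) through `B15Prop1SliceNondegeneracyFromRealCoerciveTowerB.analyticAt_sliceDatum_of_guardOn`, and the SUPPORT clause (real kernel fields vanish on the bonds
sourced off `Ω₁(Z)`) is DISCHARGED by the level-`0` kernel dictionary `B15Prop1LinearisedKernelLevelZero` at `Γ₀ = Ω₁ᶜ` (`B14.Eq213DetSet.Bj_zero`, `0 < k`).  Every other row ((E), the datum's regularity on `Z`, forest (F1)(F2)(F3), `a`, `Φ₀`, (45) velocity,
(T1@q₀), the class facts, radius letter, floors) is the capstone's VERBATIM.
[cite: Balaban1989LargeFieldII, p.357, (1.7)–(1.9) p.358, (1.12) p.359; Balaban1989LargeFieldI, (1.74) p.192, Prop. 1 p.194; Balaban1985Variational, Thm 1 p.279, Sect. C (45) p.285, Sect. G pp.305–307; Balaban1988Convergent, (2.2) p.255, (2.10)–(2.13) pp.256–257; Balaban1984PropagatorsI, (1.65)–(1.67)] -/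
theorem hMin_atRecord_of_node00Letters_thm1AtBase_central_ofClass_nearFlat (ν : Node00.Stage7Numerics) (Kt : ℕ) (hd : 2 ≤ (F.P Kt).d) (Z : Set (Site (F.P Kt) 0))
    (Λ : Set (Site (F.P Kt) k)) (lo hi : Fin (F.P Kt).d → ℤ) (𝔅 : BDetSet (F.P Kt)) (h𝔅Z : 𝔅 = lamBondsSeq (maxDomT ν.M₁ Z) k) (hkK : k + 1 ≤ (F.P Kt).m + (F.P Kt).K)
    (hM4 : 4 * (F.P Kt).L ≤ ν.M₁) (hdiv : side (F.P Kt).L ν.M₁ k ∣ (F.P Kt).sitesPerDir 0) (hZblk : B14.Eq22Determines.IsBlockUnion k Z) (hε : 0 ≤ ν.εreg)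
    {ρ'' : ℝ} (hsbU : ∀ W : GaugeField (F.P Kt) 0 SU2, ‖coeField W - 1‖ ≤ ρ'' → SmallBelow (Node00.avOfRecord F 2 Kt) k W)
    (hερ : 6 * ((((F.P Kt).d - 1 : ℕ)) : ℝ) * (F.P Kt).L * ν.εreg ≤ ρ'') {δ : ℝ} (hδ : 0 < δ) (hδρ : 6 * ((((F.P Kt).d - 1 : ℕ)) : ℝ) * (F.P Kt).L ^ k * δ ≤ ρ'')
    (ext : GaugeField (F.P Kt) k SU2 → GaugeField (F.P Kt) k SU2) (hext : ∀ W, ext W = extend Λ (shellGauge W lo hi) W)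
    {K : Set (GaugeField (F.P Kt) k SU2)} (hK : IsCompact K) {𝓐₀ : ℝ} (h𝓐₀ : 1 < 𝓐₀)
    (reg' : Set (GaugeField (F.P Kt) 0 SU2)) (hreg' : IsClosed reg') (hcl : closure (Node00.regMSCoPOfRecord F 2 ν Kt k (maxDomT ν.M₁ Z)) ⊆ reg')
    (hDreg' : ContinuousOn (fun (U : GaugeField (F.P Kt) 0 SU2) (i : Fin (constrCardB 𝔅 k)) =>
      ((avgFamily (Node00.avOfRecord F 2 Kt) U ((constrEnumB 𝔅 k).symm i).1 ((constrEnumB 𝔅 k).symm i).2.1 : SU2) : Matrix (Fin 2) (Fin 2) ℂ)) reg')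
    -- ONCE per height: the numerics of the (β) split — the near-flat tolerance, the flat coercivity constant, the multiplier constant
    (S₀ : Set (PBond (F.P Kt) 0)) (hS₀ : ∀ b ∉ S₀, b ∈ lamBondsSeq (maxDomT ν.M₁ Z) k 0) {δc cP m : ℝ} (hδc0 : 0 ≤ δc) (hnum : 64 * (((F.P Kt).d : ℝ) - 1) * δc + m < cP)
    (hbase : ∀ Vk ∈ K, ∃ (U₀ : GaugeField (F.P Kt) 0 SU2) (S : Submodule ℂ (VecField (F.P Kt) 0 (EuclideanSpace ℂ (Fin 3)))) (path : Site (F.P Kt) 0 → List (LStep (F.P Kt) 0))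
        (a : S → ℂ) (Φ₀ : S → Fin (constrCardB 𝔅 k) → EuclideanSpace ℂ (Fin 3)),
      IsMinimizerB (Node00.avOfRecord F 2 Kt) (Node00.regMSCoPOfRecord F 2 ν Kt k (maxDomT ν.M₁ Z)) 𝔅
        (avgFamily (Node00.avOfRecord F 2 Kt) (qsstarGIter0 k (ext Vk))) U₀ ∧
      PlaqSmallOn (plaqsInside (pts k Z)) δ (ext Vk) ∧
      (∀ x, ∀ s ∈ path x, ∃ x' x'' : Site (F.P Kt) 0, path x'' = path x' ++ [s] ∧
        (s.fwd = true → s.bond.src = x' ∧ s.bond.tgt = x'') ∧ (s.fwd = false → s.bond.src = x'' ∧ s.bond.tgt = x')) ∧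
      (∀ j, j ≤ k → ∀ c ∈ (𝔅 j), path (embIter j c.src) = [] ∧ path (embIter j c.tgt) = []) ∧
      (∀ X : VecField (F.P Kt) 0 (EuclideanSpace ℂ (Fin 3)), X ∈ S ↔ ∀ x, ∀ s ∈ path x, X s.bond = 0) ∧
      (∀ X : S, a X = ∑ p : Plaq (F.P Kt) 0, (1 - (expMulC (X : VecField (F.P Kt) 0 (EuclideanSpace ℂ (Fin 3))) (coeField U₀) ⟨p.src, p.μ⟩ *
        expMulC (X : VecField (F.P Kt) 0 (EuclideanSpace ℂ (Fin 3))) (coeField U₀) ⟨p.src.shift p.μ, p.ν⟩ *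
        Matrix.adjugate (expMulC (X : VecField (F.P Kt) 0 (EuclideanSpace ℂ (Fin 3))) (coeField U₀) ⟨p.src.shift p.ν, p.μ⟩) *
        Matrix.adjugate (expMulC (X : VecField (F.P Kt) 0 (EuclideanSpace ℂ (Fin 3))) (coeField U₀) ⟨p.src, p.ν⟩)).trace / 2)) ∧
      (∀ (X : S) i, Φ₀ X i = logCoordC (star ((avgFamily (Node00.avOfRecord F 2 Kt) (qsstarGIter0 k (ext Vk))
        ((constrEnumB 𝔅 k).symm i).1 ((constrEnumB 𝔅 k).symm i).2.1 : SU2) : Matrix (Fin 2) (Fin 2) ℂ) *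
        iterMh ((constrEnumB 𝔅 k).symm i).1 (expMulC (X : VecField (F.P Kt) 0 (EuclideanSpace ℂ (Fin 3))) (coeField U₀)) ((constrEnumB 𝔅 k).symm i).2.1)) ∧
      -- (45), VELOCITY currency — the capstone's row verbatim
      (∀ τ : Fin (constrCardB 𝔅 k) → EuclideanSpace ℝ (Fin 3), ∃ p : VecField (F.P Kt) 0 E3, cplxVec p ∈ S ∧
        ∀ i : Fin (constrCardB 𝔅 k), HasDerivAt (fun s : ℝ => ((avgFamily (Node00.avOfRecord F 2 Kt) (expMul su2Chart (s • p) U₀)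
          ((constrEnumB 𝔅 k).symm i).1 ((constrEnumB 𝔅 k).symm i).2.1 : SU2) : Matrix (Fin 2) (Fin 2) ℂ))
          (((avgFamily (Node00.avOfRecord F 2 Kt) (qsstarGIter0 k (ext Vk)) ((constrEnumB 𝔅 k).symm i).1
            ((constrEnumB 𝔅 k).symm i).2.1 : SU2) : Matrix (Fin 2) (Fin 2) ℂ) * ∑ b : Fin 3, ((τ i b : ℝ) : ℂ) • genE b) 0) ∧
      -- (δ) DISPLAYED (GAUGE letter, the direct road's (N)-package clause): `U₀` bondwise `δc`-flat on the plaquettes meeting a bond sourced in `Ω₁(Z)`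
      (∀ q : Plaq (F.P Kt) 0, ((⟨q.src, q.μ⟩ : PBond (F.P Kt) 0) ∈ S₀ ∨
          (⟨q.src.shift q.μ, q.ν⟩ : PBond (F.P Kt) 0) ∈ S₀ ∨
          (⟨q.src.shift q.ν, q.μ⟩ : PBond (F.P Kt) 0) ∈ S₀ ∨
          (⟨q.src, q.ν⟩ : PBond (F.P Kt) 0) ∈ S₀) →
        ‖((U₀ ⟨q.src, q.μ⟩ : SU2) : Matrix (Fin 2) (Fin 2) ℂ) - 1‖ ≤ δc ∧ ‖((U₀ ⟨q.src.shift q.μ, q.ν⟩ : SU2) : Matrix (Fin 2) (Fin 2) ℂ) - 1‖ ≤ δc ∧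
          ‖((U₀ ⟨q.src.shift q.ν, q.μ⟩ : SU2) : Matrix (Fin 2) (Fin 2) ℂ) - 1‖ ≤ δc ∧ ‖((U₀ ⟨q.src, q.ν⟩ : SU2) : Matrix (Fin 2) (Fin 2) ℂ) - 1‖ ≤ δc) ∧
      -- (P) DISPLAYED: FLAT COERCIVITY on the real kernel ((1.8) ∕ [10] (1.67) currency)
      (∀ (p : VecField (F.P Kt) 0 E3) (hp : cplxVec p ∈ S), fderiv ℂ Φ₀ 0 ⟨cplxVec p, hp⟩ = 0 →
        cP * ∑ b : PBond (F.P Kt) 0, ‖p b‖ ^ 2 ≤ deriv (deriv fun s : ℝ => wilsonAction4 (expMul su2Chart (s • p) (1 : GaugeField (F.P Kt) 0 SU2))) 0) ∧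
      -- (M) DISPLAYED: the MULTIPLIER letter, for every multiplier of the base state
      (∀ ℓ₀ : (Fin (constrCardB 𝔅 k) → EuclideanSpace ℂ (Fin 3)) →L[ℂ] ℂ, fderiv ℂ a 0 = ℓ₀.comp (fderiv ℂ Φ₀ 0) →
        ∀ (p : VecField (F.P Kt) 0 E3) (hp : cplxVec p ∈ S), fderiv ℂ Φ₀ 0 ⟨cplxVec p, hp⟩ = 0 →
          (ℓ₀ (fderiv ℂ (fderiv ℂ Φ₀) 0 ⟨cplxVec p, hp⟩ ⟨cplxVec p, hp⟩)).re ≤ m * ∑ b : PBond (F.P Kt) 0, ‖p b‖ ^ 2) ∧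
      -- (T1@q₀) — the capstone's row verbatim
      (∀ U ∈ reg', AgreeOnB 𝔅 (avgFamily (Node00.avOfRecord F 2 Kt) U) (avgFamily (Node00.avOfRecord F 2 Kt) (qsstarGIter0 k (ext Vk))) →
        wilsonAction4 U ≤ wilsonAction4 U₀ →
          ∃ u : GaugeTransf (F.P Kt) 0 SU2, (∀ j, j ≤ k → ∀ b ∈ (𝔅 j), toMS u j b.src = toMS u j b.tgt ∧ ∀ g : SU2, toMS u j b.src * g = g * toMS u j b.src) ∧ gaugeAct u U = U₀)) :
    ∃ R : ℝ, 0 < R ∧ ∀ Vk ∈ K,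
      ∃ Ũ : VecField (F.P Kt) k (EuclideanSpace ℂ (Fin 3)) × VecField (F.P Kt) k (EuclideanSpace ℂ (Fin 3)) → PBond (F.P Kt) 0 → Matrix (Fin 2) (Fin 2) ℂ,
        (∀ b i j, DifferentiableOn ℂ (fun z => Ũ z b i j) (ball 0 R)) ∧
        (∀ z ∈ ball (0 : VecField (F.P Kt) k (EuclideanSpace ℂ (Fin 3)) × VecField (F.P Kt) k (EuclideanSpace ℂ (Fin 3))) R, ∀ b i j, ‖Ũ z b i j‖ ≤ 𝓐₀) ∧
        ∀ p B' : VecField (F.P Kt) k E3, ‖p‖ < R → ‖B'‖ < R → ∃ U' : GaugeField (F.P Kt) 0 SU2,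
          (∀ b, Ũ (cplxVec p, cplxVec B') b = ((U' b : SU2) : Matrix (Fin 2) (Fin 2) ℂ)) ∧
            IsMinimizerB (Node00.avOfRecord F 2 Kt) (Node00.regMSCoPOfRecord F 2 ν Kt k (maxDomT ν.M₁ Z)) 𝔅
              (avgFamily (Node00.avOfRecord F 2 Kt) (qsstarGIter0 k (expMul su2Chart B' (ext (expMul su2Chart p Vk))))) U' := by
  subst h𝔅Z
  have hk : k ≤ (F.P Kt).m + (F.P Kt).K := Nat.le_of_succ_le hkK
  refine hMin_atRecord_of_node00Letters_thm1AtBase_central_ofClass ν Kt hd Z Λ lo hi (lamBondsSeq (maxDomT ν.M₁ Z) k) rfl hkK hM4 hdiv hZblk hε hsbU hερ hδ hδρ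
    ext hext hK h𝓐₀ reg' hreg' hcl hDreg' fun Vk hVk => ?_
  obtain ⟨U₀, S, path, a, Φ₀, hmin, hreg, hF1, hF2, hF3, ha, hΦ₀, hH, hNF, hP, hM, hT1⟩ := hbase Vk hVk
  -- the slice datum coordinates are analytic at `0` under the minimiser's per-tower guards (read off its class)
  have hgU := guardOn_towerRegion_lamBondsSeq_of_mem_class ν Kt Z hkK hM4 hdiv hε hsbU hερ hmin.1
  have hΦan : AnalyticAt ℂ Φ₀ 0 := analyticAt_sliceDatum_of_guardOn S (lamBondsSeq (maxDomT ν.M₁ Z) k) k hk _ hgU hmin.2.1 hΦ₀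
  -- the SUPPORT clause: a real kernel field vanishes on every bond sourced off `Ω₁(Z)` (level-`0` kernel dictionary at `Γ₀ = Ω₁ᶜ`)
  have hker0 : ∀ (p : VecField (F.P Kt) 0 E3) (hp : cplxVec p ∈ S), fderiv ℂ Φ₀ 0 ⟨cplxVec p, hp⟩ = 0 →
      ∀ b ∉ S₀, p b = 0 := fun p hp hker b hb =>
    apply_eq_zero_of_fderiv_sliceDatum_eq_zero_of_mem_bondsOf_zero_of_guardOn (lamBondsSeq (maxDomT ν.M₁ Z) k) k hk _ hgU hmin.2.1 S hΦ₀ hp hker b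
      (hS₀ b hb)
  refine ⟨U₀, S, path, a, Φ₀, hmin, hreg, hF1, hF2, hF3, ha, hΦ₀, hH, fun ℓ₀ hℓ₀ => ?_, hT1⟩
  -- the (β) row from (δ) + (P) + (M) along print's road (1.7) + (1.8)
  exact realSecondVariation_pos_of_flatCoercive_of_multiplier S ha hΦan.contDiffAt ℓ₀ S₀
    hker0 hδc0 hNF hP (hM ℓ₀ hℓ₀) hnum

end

end Summit.QuantumFields.YangMills.BalabanUVNodes.N12MinimiserFamilyOfClassNearFlatCoerciveB

end
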